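import Literature.Barriers.CriticalPhenomena.GridSAWSquaresPlacement
import Literature.Barriers.CriticalPhenomena.GridSAWCountingAnyLengthViaGridHamPath
import Literature.Barriers.CriticalPhenomena.GridSAWTowersReduction
import HarnessLib

/-!
# Barrier `GridSAWCountingSharpPComplete`, squares step: "`Y` can be recovered by
# right-bit-shifting" — the instance map `R₁(x) = (E₃, τ)` and the shift `R₃` as string functions,
# their correctness on ALL strings, and the reduction of `LOT2003_thm7_anyLength_squares` to one
# machine fact

Sibling of `GridSAWCountingAnyLengthViaGridHamPath.lean` (the named sub-fact
`LOT2003_thm7_anyLength_squares : GRIDHAMPATHCOUNT ≤ᵖ_{r-shift} SAWCOUNT₄` of Theorem 7 (4) of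
Liśkiewicz–Ogihara–Toda 2003, and the abstract right-shift estimate
`sum_two_pow_mul_div_eq_card`), of `GridSAWSquaresPlacement.lean` (the concrete squares
`sqSites k β D` on the scaled drawing `scaleDrawing k D`, `isSiteList_sqSites`, and the count
`ncard_saw_squares`: for `s ≠ t` the SAWs of the decorated scaled drawing between the images of
`s` and `t` number `Σ_π 2^{β · #edges(π)}` over the abstract simple `s`–`t` paths), of
`GridSAWAnyLengthDrawingCount.lean` (degenerate end points, `sawCountAnyLength_translate`, the
bound `card_filter_absPathsFromTo_lt_two_pow`) and of `GridSAWTowersReduction.lean` (the same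
programme for the tower step of version (1): `towerCode`, `SAWCOUNT₁_towerCode`, the machine fact
`LOT2003_thm7_fixedLength_towers_FP`). Here the squares step is closed down to the level of
STRINGS and its machine part is isolated as a single named statement:

> "Since `β ≥ N`, the number of SAWs between the origin and the image of `t′` in `E₃` is
> [`Y · 2^{β(N+1)} + ε`, `0 ≤ ε < 2^{β(N+1)}`]. Then the pair `(R₁, R₃)` witnesses that the fourth
> type is complete for `#P` under `≤ᵖ_{r-shift}`-reductions." [LOT2003, §4, proof of Theorem 7,
> PDF pp. 11–12]

## What is formalised (namespace `Literature.Barriers.CriticalPhenomena.GridSAW`)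

* **`ncard_saw_squares_div_eq_hamPathCount`**: with `β > N²` (so that the abstract simple
  `s`–`t` paths, fewer than `2^{N²+1}`, are fewer than `2^β`) and `2β + 3 ≤ k`, the count of
  `ncard_saw_squares` divided by `2^{β(N-1)}` is the number `Y` of Hamiltonian `s`–`t` paths
  (the source's `G′` has `N + 2` nodes, hence its exponent `β(N+1)`; its `β = L² ≥ N` uses the
  degree-three bound on `η`);
* the parameters `squaresBeta N = N² + 1`, `squaresK N = 2β + 3`, **the instance
  `squaresInstance P D s t = (E₃ - σ, τ - σ)`** (`σ`, `τ` the scaled images of `s`, `t`),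
  `squaresShift N = β (N - 1)`, `isGridSubgraph_squaresInstance`, and
  **`sawCountAnyLength_squaresInstance_div`**: for a valid presentation with `N ≥ 2`,
  `sawCountAnyLength E τ div 2^{shift} = hamPathCount N D s t` (for `s = t` both vanish);
* the two fixed instances: the empty graph (`sawCountAnyLength_nil`, image of the invalid
  presentations) and the unit square (`sawCountAnyLength_unitSquare = 2`, image of the valid
  one-vertex presentations, whose Hamiltonian path `[0]` must count once after a shift by one);
* `squaresReduce`, `squaresReduceShift` — `R₁`, `R₃` on strings (decode with the pivot's
  `encodingDrawnGraphInstance`, branch, encode with the barrier's `encodingAnyLengthInstance`),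
  `squaresReduceShift_pos`, and **`GRIDHAMPATHCOUNT_eq_SAWCOUNT₄_div`: for every string `w`,
  `GRIDHAMPATHCOUNT w = SAWCOUNT₄ (squaresReduce w) div 2^{squaresReduceShift w}`**;
* the remaining machine content as the named fact `LOT2003_thm7_anyLength_squares_FP`
  (`squaresReduce ∈ FP ∧ encodeNat ∘ squaresReduceShift ∈ FP`), and the PROVED reductions
  `LOT2003_thm7_anyLength_squares_of` / `…_of_FP`, the flexible
  `LOT2003_thm7_anyLength_squares_of_mem_FP` (any `FP` map with the same `SAWCOUNT₄`-values and
  any `FP` presentation of the shift serve), and `LOT2003_thm7_anyLength_of_lemma4_of_FP`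
  (Theorem 7 (4) from membership, `LOT2003_lemma4_grid` and the machine fact).

## References

* M. Liśkiewicz, M. Ogihara, S. Toda, *The complexity of counting self-avoiding walks in
  subgraphs of two-dimensional grids and hypercubes*, TCS 304 (2003) 129–156, §4, proof of
  Theorem 7 (fourth type: `E₃`, `β`, "`Y` can be recovered … by right-bit-shifting",
  `(R₁, R₃)`), §2.2 (`≤ᵖ_{r-shift}`: `R₁`, `R₃` polynomial-time, `R₃ ≥ 1`).
-/

noncomputable section

namespace Literature.Barriers.CriticalPhenomena.GridSAW

open _root_.Computability Literature.Computability.Complexity Finset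

section Drawing

variable {P : List GridPoint} {D : List DrawnEdge}

/-! ### The count, right-shifted -/

/-- `sawFinset` has as many members as the set of SAWs it enumerates. [folklore] -/
theorem card_sawFinset_eq_ncard (E : EdgeList) (a b : GridPoint) :
    (sawFinset E a b).card = {ω : List GridPoint | IsSAWIn E ω ∧ ω.head? = some a ∧
      ω.getLast? = some b}.ncard := by
  rw [← Set.ncard_coe_finset]
  congr 1
  ext ω
  rw [Finset.mem_coe, mem_sawFinset_iff, Set.mem_setOf_eq]

/-- **"`Y` can be recovered by right-bit-shifting"**: for `s ≠ t` (so `N ≥ 2`), `N² < β` and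
`2β + 3 ≤ k`, the number of SAWs of the decorated scaled drawing between the images of `s` and
`t` (`ncard_saw_squares`: `Σ_l 2^{β(|l|-1)}` over the abstract simple `s`–`t` paths), divided
by `2^{β(N-1)}`, is the number of Hamiltonian `s`–`t` paths: the Hamiltonian paths contribute
`2^{β(N-1)}` each, the other simple paths at most `2^{β(N-2)}` each, and there are fewer than
`2^{N²+1} ≤ 2^β` of them (`sum_two_pow_mul_div_eq_card`).
[cite: LiskiewiczOgiharaToda2003, Theorem 7 (proof, fourth type: "Since β ≥ N, the number of SAWs between the origin and the image of t′ in E₃ is … Then the pair (R₁, R₃) witnesses that the fourth type is complete")] -/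
theorem ncard_saw_squares_div_eq_hamPathCount (hD : IsGridDrawing P D) {k β : ℕ}
    (hk : 2 * β + 3 ≤ k) (hβ : P.length * P.length < β) {s t : ℕ} (hs : s < P.length)
    (ht : t < P.length) (hst : s ≠ t) :
    {ω : List GridPoint | IsSAWIn (withSquares (scaleDrawing k D) (sqSites k β D)) ω ∧
        ω.head? = some ((k : ℤ) • P[s]) ∧ ω.getLast? = some ((k : ℤ) • P[t])}.ncard /
        2 ^ (β * (P.length - 1)) = hamPathCount P.length D s t := by
  classical
  rw [ncard_saw_squares hD hk hs ht hst, hamPathCount_eq_card_filter]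
  have hN : 2 ≤ P.length := by omega
  refine sum_two_pow_mul_div_eq_card _ (fun l : List ℕ => l.length = P.length)
    (fun l : List ℕ => l.length - 1) β (P.length - 1) (by omega) (fun l _ h => by rw [h]) ?_ ?_
  · intro l hl h
    have := length_le_of_mem_absPathsFromTo ((Set.Finite.mem_toFinset _).mp hl)
    omega
  · exact lt_of_lt_of_le (card_filter_absPathsFromTo_lt_two_pow _ _ _ _ _)
      (Nat.pow_le_pow_right (by norm_num) hβ)

/-! ### The instance from the origin -/

/-- The parameters of the reduction: `β = N² + 1`, `k = 2β + 3`. [folklore] -/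
def squaresBeta (N : ℕ) : ℕ := N * N + 1

/-- The enlargement factor `k = 2β + 3`. [folklore] -/
def squaresK (N : ℕ) : ℕ := 2 * squaresBeta N + 3

/-- **The instance `(E₃ - σ, τ - σ)` of version (4) built from a drawn graph `(P, D, s, t)`**
(`σ = k • P[s]`, `τ = k • P[t]` the images of `s`, `t` in the decorated scaled drawing; `img`
reads the vertex images with the junk value `gridOrigin` out of range).
[cite: LiskiewiczOgiharaToda2003, Theorem 7 (proof, fourth type: E₃, "the number of SAWs between the origin and the image of t′")] -/
def squaresInstance (P : List GridPoint) (D : List DrawnEdge) (s t : ℕ) : EdgeList × GridPoint :=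
  let k := squaresK P.length
  (translate (-((k : ℤ) • img P s)) (withSquares (scaleDrawing k D) (sqSites k (squaresBeta P.length) D)),
    (k : ℤ) • img P t - (k : ℤ) • img P s)

/-- **The shift `β (N - 1)`.** [cite: LiskiewiczOgiharaToda2003, Theorem 7 (proof, fourth type: R₃)] -/
def squaresShift (N : ℕ) : ℕ := squaresBeta N * (N - 1)

/-- The instance is a subgraph of the grid. [cite: LiskiewiczOgiharaToda2003, §4 (proof of Theorem 7, E₃)] -/
theorem isGridSubgraph_squaresInstance (hD : IsGridDrawing P D) (s t : ℕ) :
    IsGridSubgraph (squaresInstance P D s t).1 :=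
  isGridSubgraph_translate (isGridSubgraph_withSquares_sqSites hD (by unfold squaresK; omega) _) _

/-- **The counting identity of the squares step, instance form**: for a congestion-free grid
drawing with `N ≥ 2` vertices and `s, t < N`,
`sawCountAnyLength E τ div 2^{β(N-1)} = hamPathCount N D s t` for
`(E, τ) = squaresInstance P D s t` (for `s = t` both sides vanish: a walk from a point to
itself is the one-point walk, and `β (N - 1) ≥ 1`).
[cite: LiskiewiczOgiharaToda2003, Theorem 7 (proof, fourth type)] -/
theorem sawCountAnyLength_squaresInstance_div (hD : IsGridDrawing P D) (hN : 2 ≤ P.length)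
    {s t : ℕ} (hs : s < P.length) (ht : t < P.length) :
    sawCountAnyLength (squaresInstance P D s t).1 (squaresInstance P D s t).2 /
        2 ^ squaresShift P.length = hamPathCount P.length D s t := by
  simp only [squaresInstance, img_eq_getElem hs, img_eq_getElem ht]
  rw [sawCountAnyLength_translate]
  by_cases hst : s = t
  · subst hst
    rw [hamPathCount_self_eq_zero D hN, Nat.div_eq_of_lt]
    refine lt_of_le_of_lt (card_sawFinset_self_le_one _ _) ?_
    apply Nat.one_lt_two_pow
    unfold squaresShift squaresBeta
    exact Nat.mul_ne_zero (by omega) (by omega)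
  · rw [card_sawFinset_eq_ncard]
    exact ncard_saw_squares_div_eq_hamPathCount hD le_rfl (by unfold squaresBeta; omega) hs ht hst

end Drawing

/-! ### The special instances: the empty graph and the unit square -/

/-- The empty instance has no walks. [folklore] -/
theorem sawCountAnyLength_nil (τ : GridPoint) : sawCountAnyLength [] τ = 0 := by
  rw [sawCountAnyLength, Set.ncard_eq_zero (sawsFromOriginTo_finite _ _)]
  ext ω
  simp only [sawsFromOriginTo, Set.mem_setOf_eq, Set.mem_empty_iff_false, iff_false]
  rintro ⟨⟨hne, -, hV, -⟩, -⟩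
  obtain ⟨x, hx⟩ := List.exists_mem_of_ne_nil ω hne
  simpa [vertexSet] using hV x hx

/-- The unit square `(0,0), (1,0), (1,1), (0,1)`. [folklore] -/
def unitSquare : EdgeList :=
  [(((0 : ℤ), (0 : ℤ)), (1, 0)), ((1, 0), (1, 1)), ((0, 0), (0, 1)), ((0, 1), (1, 1))]

/-- The unit square is a subgraph of the grid. [folklore] -/
theorem isGridSubgraph_unitSquare : IsGridSubgraph unitSquare := by
  unfold IsGridSubgraph unitSquare; decide

/-- Adjacency in the unit square, explicitly. [folklore] -/
theorem adj_unitSquare_iff (x y : GridPoint) : Adj unitSquare x y ↔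
    (x = (0, 0) ∧ y = (1, 0)) ∨ (x = (1, 0) ∧ y = (1, 1)) ∨ (x = (0, 0) ∧ y = (0, 1)) ∨
      (x = (0, 1) ∧ y = (1, 1)) ∨ (x = (1, 0) ∧ y = (0, 0)) ∨ (x = (1, 1) ∧ y = (1, 0)) ∨
      (x = (0, 1) ∧ y = (0, 0)) ∨ (x = (1, 1) ∧ y = (0, 1)) := by
  simp only [Adj, unitSquare, List.mem_cons, Prod.mk.injEq, List.not_mem_nil, or_false]
  constructor
  · rintro (h | h) <;> rcases h with ⟨rfl, rfl⟩ | ⟨rfl, rfl⟩ | ⟨rfl, rfl⟩ | ⟨rfl, rfl⟩ <;> simp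
  · rintro (⟨rfl, rfl⟩ | ⟨rfl, rfl⟩ | ⟨rfl, rfl⟩ | ⟨rfl, rfl⟩ | ⟨rfl, rfl⟩ | ⟨rfl, rfl⟩ |
      ⟨rfl, rfl⟩ | ⟨rfl, rfl⟩) <;> simp

/-- **The unit square has exactly two SAWs from `(0,0)` to the opposite corner `(1,1)`**
(the image of the one-vertex instance, whose single Hamiltonian path `[0]` must be counted
once after a shift by one bit). [folklore] -/
theorem sawCountAnyLength_unitSquare : sawCountAnyLength unitSquare (1, 1) = 2 := by
  have hset : sawsFromOriginTo unitSquare (1, 1) =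
      {[((0 : ℤ), (0 : ℤ)), (1, 0), (1, 1)], [((0 : ℤ), (0 : ℤ)), (0, 1), (1, 1)]} := by
    ext ω
    simp only [sawsFromOriginTo, Set.mem_setOf_eq, Set.mem_insert_iff, Set.mem_singleton_iff]
    constructor
    · rintro ⟨⟨-, hnd, -, hch⟩, hh, hl⟩
      -- peel the walk: `(0,0)`, then a neighbour, then `(1,1)`, and it must stop there
      match ω, hh with
      | x :: r, hh =>
        simp only [List.head?_cons, Option.some.injEq, gridOrigin] at hh
        subst hh
        match r, hl, hnd, hch with
        | [], hl, _, _ => simp at hl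
        | y :: r', hl, hnd, hch =>
          have hy := (adj_unitSquare_iff _ _).mp (List.isChain_cons_cons.mp hch).1
          simp only [Prod.mk.injEq, true_and] at hy
          norm_num at hy
          rcases hy with ⟨rfl, rfl⟩ | ⟨rfl, rfl⟩
          · -- second point `(1,0)`
            match r', hl, hnd, hch with
            | [], hl, _, _ => simp at hl
            | z :: r'', hl, hnd, hch =>
              have hz := (adj_unitSquare_iff _ _).mp
                (List.isChain_cons_cons.mp (List.isChain_cons_cons.mp hch).2).1
              simp only [Prod.mk.injEq] at hz
              norm_num at hz
              rcases hz with ⟨rfl, rfl⟩ | ⟨rfl, rfl⟩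
              · match r'', hl, hnd, hch with
                | [], _, _, _ => left; rfl
                | w :: r''', hl, hnd, hch =>
                  exfalso
                  have hw := (adj_unitSquare_iff _ _).mp (List.isChain_cons_cons.mp
                    (List.isChain_cons_cons.mp (List.isChain_cons_cons.mp hch).2).2).1
                  simp only [Prod.mk.injEq] at hw
                  norm_num at hw
                  rcases hw with ⟨rfl, rfl⟩ | ⟨rfl, rfl⟩
                  · simp at hnd
                  · match r''', hl, hnd, hch with
                    | [], hl, _, _ => simp at hl
                    | v :: _, _, hnd, hch =>
                      have hv := (adj_unitSquare_iff _ _).mp (List.isChain_cons_cons.mp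
                        (List.isChain_cons_cons.mp (List.isChain_cons_cons.mp
                          (List.isChain_cons_cons.mp hch).2).2).2).1
                      simp only [Prod.mk.injEq] at hv
                      norm_num at hv
                      rcases hv with ⟨rfl, rfl⟩ | ⟨rfl, rfl⟩ <;> simp at hnd
              · simp at hnd
          · -- second point `(0,1)`
            match r', hl, hnd, hch with
            | [], hl, _, _ => simp at hl
            | z :: r'', hl, hnd, hch =>
              have hz := (adj_unitSquare_iff _ _).mp
                (List.isChain_cons_cons.mp (List.isChain_cons_cons.mp hch).2).1
              simp only [Prod.mk.injEq] at hz
              norm_num at hz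
              rcases hz with ⟨rfl, rfl⟩ | ⟨rfl, rfl⟩
              · match r'', hl, hnd, hch with
                | [], _, _, _ => right; rfl
                | w :: r''', hl, hnd, hch =>
                  exfalso
                  have hw := (adj_unitSquare_iff _ _).mp (List.isChain_cons_cons.mp
                    (List.isChain_cons_cons.mp (List.isChain_cons_cons.mp hch).2).2).1
                  simp only [Prod.mk.injEq] at hw
                  norm_num at hw
                  rcases hw with ⟨rfl, rfl⟩ | ⟨rfl, rfl⟩
                  · match r''', hl, hnd, hch with
                    | [], hl, _, _ => simp at hl
                    | v :: _, _, hnd, hch =>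
                      have hv := (adj_unitSquare_iff _ _).mp (List.isChain_cons_cons.mp
                        (List.isChain_cons_cons.mp (List.isChain_cons_cons.mp
                          (List.isChain_cons_cons.mp hch).2).2).2).1
                      simp only [Prod.mk.injEq] at hv
                      norm_num at hv
                      rcases hv with ⟨rfl, rfl⟩ | ⟨rfl, rfl⟩ <;> simp at hnd
                  · simp at hnd
              · simp at hnd
    · rintro (rfl | rfl)
      · refine ⟨⟨by simp, by decide, ?_, ?_⟩, rfl, rfl⟩
        · intro p hp; simp only [List.mem_cons, List.not_mem_nil, or_false] at hp
          rcases hp with rfl | rfl | rfl <;> simp [vertexSet, unitSquare]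
        · simp [adj_unitSquare_iff]
      · refine ⟨⟨by simp, by decide, ?_, ?_⟩, rfl, rfl⟩
        · intro p hp; simp only [List.mem_cons, List.not_mem_nil, or_false] at hp
          rcases hp with rfl | rfl | rfl <;> simp [vertexSet, unitSquare]
        · simp [adj_unitSquare_iff]
  rw [sawCountAnyLength, hset, Set.ncard_pair]
  decide

/-! ### The reduction on decoded instances -/

open Classical in
/-- **The instance map of the squares step on strings**, `R₁`: decode `(P, D, s, t)`; an invalid
presentation goes to the empty instance (no walks), a valid one-vertex instance to the unit
square (two walks), and a valid instance with `N ≥ 2` to `squaresInstance P D s t`.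
[cite: LiskiewiczOgiharaToda2003, Theorem 7 (proof, fourth type: "Define R₁(x) …")] -/
def squaresReduce (w : List Bool) : List Bool :=
  match encodingDrawnGraphInstance.decode w with
  | some (P, D, s, t) =>
    if IsGridDrawing P D ∧ s < P.length ∧ t < P.length then
      if 2 ≤ P.length then encodingAnyLengthInstance.encode (squaresInstance P D s t)
      else encodingAnyLengthInstance.encode (unitSquare, (1, 1))
    else encodingAnyLengthInstance.encode (([] : EdgeList), gridOrigin)
  | none => encodingAnyLengthInstance.encode (([] : EdgeList), gridOrigin)

open Classical in
/-- **The shift of the squares step**, `R₃`: `β (N - 1)` on valid instances with `N ≥ 2`,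
and `1` otherwise (so that it is always positive). [cite: LiskiewiczOgiharaToda2003, Theorem 7 (proof, fourth type: R₃)] -/
def squaresReduceShift (w : List Bool) : ℕ :=
  match encodingDrawnGraphInstance.decode w with
  | some (P, D, s, t) =>
    if (IsGridDrawing P D ∧ s < P.length ∧ t < P.length) ∧ 2 ≤ P.length then
      squaresShift P.length else 1
  | none => 1

/-- The shift is positive. [cite: LiskiewiczOgiharaToda2003, §2.2 ("R₃ : Σ* → ℕ − {0}")] -/
theorem squaresReduceShift_pos (w : List Bool) : 0 < squaresReduceShift w := by
  unfold squaresReduceShift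
  split
  · split
    · rename_i h
      unfold squaresShift squaresBeta
      exact Nat.mul_pos (by omega) (by omega)
    · exact Nat.one_pos
  · exact Nat.one_pos

/-- **The squares step is correct**: for every string `w`,
`GRIDHAMPATHCOUNT w = SAWCOUNT₄ (squaresReduce w) div 2^{squaresReduceShift w}` — the
object-level content of `GRIDHAMPATHCOUNT ≤ᵖ_{r-shift} SAWCOUNT₄`; with the polynomial-time
computability of the two maps (sequel) this is `LOT2003_thm7_anyLength_squares`.
[cite: LiskiewiczOgiharaToda2003, Theorem 7 (proof, fourth type: "Then the pair (R₁, R₃) witnesses that the fourth type is complete for #P under ≤ᵖ_{r-shift}-reductions")] -/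
theorem GRIDHAMPATHCOUNT_eq_SAWCOUNT₄_div (w : List Bool) :
    GRIDHAMPATHCOUNT w = SAWCOUNT₄ (squaresReduce w) / 2 ^ squaresReduceShift w := by
  classical
  have hempty : SAWCOUNT₄ (encodingAnyLengthInstance.encode (([] : EdgeList), gridOrigin)) = 0 := by
    rw [SAWCOUNT₄_encode _ _ (fun e he => by simp at he), sawCountAnyLength_nil]
  unfold GRIDHAMPATHCOUNT squaresReduce squaresReduceShift
  cases hdec : encodingDrawnGraphInstance.decode w with
  | none => simp only [hempty, Nat.zero_div]
  | some i =>
    obtain ⟨P, D, s, t⟩ := i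
    simp only
    by_cases hvalid : IsGridDrawing P D ∧ s < P.length ∧ t < P.length
    · rw [if_pos hvalid, if_pos hvalid]
      by_cases hN : 2 ≤ P.length
      · rw [if_pos hN, if_pos ⟨hvalid, hN⟩,
          SAWCOUNT₄_encode _ _ (isGridSubgraph_squaresInstance hvalid.1 s t),
          sawCountAnyLength_squaresInstance_div hvalid.1 hN hvalid.2.1 hvalid.2.2]
      · rw [if_neg hN, if_neg (fun h => hN h.2), SAWCOUNT₄_encode _ _ isGridSubgraph_unitSquare,
          sawCountAnyLength_unitSquare]
        have hN1 : P.length = 1 := by omega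
        have hs0 : s = 0 := by omega
        have ht0 : t = 0 := by omega
        subst hs0; subst ht0
        rw [eq_nil_of_isGridDrawing_of_length_eq_one hvalid.1 hN1, hN1, hamPathCount_one_nil]
        norm_num
    · rw [if_neg hvalid, if_neg hvalid, if_neg (fun h => hvalid h.1), hempty]
      simp

/-- The squares step in the form of the named sub-fact, conditional on the two machines: if
`squaresReduce ∈ FP` and `encodeNat ∘ squaresReduceShift ∈ FP` then
`LOT2003_thm7_anyLength_squares` (`GRIDHAMPATHCOUNT ≤ᵖ_{r-shift} SAWCOUNT₄`).
[cite: LiskiewiczOgiharaToda2003, Theorem 7 (proof, fourth type)] -/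
theorem LOT2003_thm7_anyLength_squares_of (h₁ : squaresReduce ∈ FP)
    (h₃ : (encodeNat ∘ squaresReduceShift) ∈ FP) : LOT2003_thm7_anyLength_squares :=
  ⟨squaresReduce, h₁, squaresReduceShift, h₃, squaresReduceShift_pos,
    GRIDHAMPATHCOUNT_eq_SAWCOUNT₄_div⟩

/-- **More flexibly, for the machine builder**: ANY polynomial-time `R` whose outputs have the
same `SAWCOUNT₄`-values as those of `squaresReduce` (another edge order, another code of the
same instance, …) together with any polynomial-time presentation of the shift discharges the
squares step. [cite: LiskiewiczOgiharaToda2003, Theorem 7 (proof, fourth type) and §2.2] -/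
theorem LOT2003_thm7_anyLength_squares_of_mem_FP {R : List Bool → List Bool} (hR : R ∈ FP)
    (hRv : ∀ w, SAWCOUNT₄ (R w) = SAWCOUNT₄ (squaresReduce w)) {S : List Bool → ℕ}
    (hS : (encodeNat ∘ S) ∈ FP) (hSv : ∀ w, S w = squaresReduceShift w) :
    LOT2003_thm7_anyLength_squares :=
  ⟨R, hR, S, hS, fun w => (hSv w).symm ▸ squaresReduceShift_pos w,
    fun w => by rw [hRv, hSv]; exact GRIDHAMPATHCOUNT_eq_SAWCOUNT₄_div w⟩

/-- **The remaining machine content of the squares step, as a named fact**: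
`squaresReduce ∈ FP` and `encodeNat ∘ squaresReduceShift ∈ FP` — the polynomial-time
computability of `R₁` and `R₃` ("Then the pair `(R₁, R₃)` witnesses that the fourth type is
complete for `#P` under `≤ᵖ_{r-shift}`-reductions"; `R₁`, `R₃` are polynomial-time by the
definition of `≤ᵖ_{r-shift}`, §2.2), for THIS variant of `E₃` (the squares `sqSites` of `GridSAWSquaresPlacement` on the scaled
drawing, `β = N² + 1`, `k = 2β + 3`; the printed `E₃` sits on the towered `E₂` with `β = L²`).
A programming task in the tree's `TM2`-based `FP`, to be assembled from the brick toolkit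
(`Literature/Computability/Complexity/`) and the input-side machines of the tower step
(`GridSAWDrawingChecker.drawingChk`: `IsGridDrawing` as a one-bit `FP` test;
`GridSAWInstanceCanon`): decode, test validity and `N ≥ 2`, compute `β`, `k`, the scaled
paths, the `3β|D|` square edges, translate, encode; and `β (N - 1)` in binary. Not proved here.
[cite: LiskiewiczOgiharaToda2003, Theorem 7 (proof, fourth type: "Then the pair (R₁, R₃) witnesses …") and §2.2 (definition of ≤ᵖ_{r-shift}: R₁, R₃ polynomial-time computable)] -/
def LOT2003_thm7_anyLength_squares_FP : Prop :=
  squaresReduce ∈ FP ∧ (encodeNat ∘ squaresReduceShift) ∈ FP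

/-- The squares step from the machine fact. [cite: LiskiewiczOgiharaToda2003, Theorem 7 (proof, fourth type)] -/
theorem LOT2003_thm7_anyLength_squares_of_FP (h : LOT2003_thm7_anyLength_squares_FP) :
    LOT2003_thm7_anyLength_squares :=
  LOT2003_thm7_anyLength_squares_of h.1 h.2

/-- **Theorem 7 (4) from the remaining facts.** With the membership half
(`LOT2003_thm7_anyLength_mem`, discharged in `GridSAWCountingVerifier.lean`) supplied as a
hypothesis to keep the verifier machines out of this file's imports, `LOT2003_thm7_anyLength`
follows from Lemma 4 with the embedding (`LOT2003_lemma4_grid`, shared with version (1)) and the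
machine fact of the squares step. [cite: LiskiewiczOgiharaToda2003, Theorem 7 (version (4))] -/
theorem LOT2003_thm7_anyLength_of_lemma4_of_FP (hmem : LOT2003_thm7_anyLength_mem)
    (h4 : LOT2003_lemma4_grid) (hFP : LOT2003_thm7_anyLength_squares_FP) : LOT2003_thm7_anyLength :=
  LOT2003_thm7_anyLength_of hmem h4 (LOT2003_thm7_anyLength_squares_of_FP hFP)

end Literature.Barriers.CriticalPhenomena.GridSAW
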